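import Summits.PneNP.PneNP.Theorems.SymmetryBudgetNoHiddenOrderPerPathCGBudget

/-!
# Runs of the label-driven replay: fuel algebra, exactness up to a last self-choice, atoms of iterates and of isolated vertices

Route `PneNP/SymmetryBudget`, `NoHiddenOrder` (stmt-PneNP-14781). Preliminaries for the POINTER BRIDGE `…PerPathCGPointer.lean` between the
certified-label scheme on the components-only Corneil–Goldberg process and the symmetric replay circuit of (R2c), which runs
`BranchSum.replay G S hgt v F St` once per pointer `v` with a fixed fuel `F`:

* the replay algebra: the step condition `RCond`, one-step unfoldings, finality (`replay_of_not_cond`, `replay_of_card_lt_two`), additivity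
  of fuel `replay_add` and `replay_eq_of_le` (a final state is kept by every larger fuel);
* replay exactness when the LAST OR-choice may be the pointer itself (`filter_max_eq_singleton'`, `replay_timed_le`, `replay_eq_timed_of_last`;
  `…PerPathReplay.replay_timed` needs all choices to avoid the pointer) — the run of a NAMED pointer ends by individualising itself;
* atoms: `atom_iterate` (the atom of an iterate of the atom step is the atom), `atom_eq_singleton_of_isolated`, and
  `atom_refineIn_indiv_self` (after individualising `u` and refining, the atom of `u` is `{u}`).
-/

-- `Summit.PneNP.PneNP.…` duplicates `PneNP` BY DESIGN (single-problem summit, D-0017 layout).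
set_option linter.dupNamespace false

namespace Summit.PneNP.PneNP.Theorems

open Finset

namespace BranchSum

variable {V : Type*} [DecidableEq V] {G : SimpleGraph V} [DecidableRel G.Adj]

/-! ### The replay algebra -/

section ReplayAlgebra

/-- The STEP CONDITION of `replay` at a state: at least two vertices and exactly one dominating label point in the first smallest cell
(it does not depend on the graph). -/
abbrev RCond (S : Finset V) (c : V → ℕ) (St : Finset V × (V → ℕ)) : Prop :=
  2 ≤ St.1.card ∧
    ((smallestCell St.1 St.2 ∩ S).filter fun y => ∀ y' ∈ smallestCell St.1 St.2 ∩ S, y' ≠ y → c y' < c y).card = 1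

variable {S : Finset V} {c : V → ℕ} {v : V}

/-- No fuel: stay. -/
theorem replay_zero (St : Finset V × (V → ℕ)) : replay G S c v 0 St = St := by rw [replay]

/-- A step is taken when the condition holds. -/
theorem replay_succ_of_cond {St : Finset V × (V → ℕ)} (h : RCond S c St) (f : ℕ) :
    replay G S c v (f + 1) St = replay G S c v f (orStep G v St (Finset.card_eq_one.1 h.2).choose) := by
  rw [replay, dif_pos h]

/-- Nothing happens when the condition fails. -/
theorem replay_succ_of_not {St : Finset V × (V → ℕ)} (h : ¬ RCond S c St) (f : ℕ) : replay G S c v (f + 1) St = St := by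
  rw [replay, dif_neg h]

/-- A state where the condition fails is final. -/
theorem replay_of_not_cond {St : Finset V × (V → ℕ)} (h : ¬ RCond S c St) (f : ℕ) : replay G S c v f St = St := by
  cases f with
  | zero => exact replay_zero St
  | succ f => exact replay_succ_of_not h f

/-- A block with fewer than two vertices is final. -/
theorem replay_of_card_lt_two {St : Finset V × (V → ℕ)} (h : St.1.card < 2) (f : ℕ) : replay G S c v f St = St :=
  replay_of_not_cond (fun hc => absurd hc.1 (not_le.2 h)) f

/-- **Fuel is additive**: `replay (a + b) = replay b ∘ replay a`. -/
theorem replay_add (a b : ℕ) (St : Finset V × (V → ℕ)) : replay G S c v (a + b) St = replay G S c v b (replay G S c v a St) := by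
  induction a generalizing St with
  | zero => rw [Nat.zero_add, replay_zero]
  | succ a ih =>
    rw [Nat.add_right_comm]
    by_cases h : RCond S c St
    · rw [replay_succ_of_cond h, replay_succ_of_cond h, ih]
    · rw [replay_succ_of_not h, replay_succ_of_not h, replay_of_not_cond h]

/-- Monotonicity in the fuel once final: if `replay a` is final then every larger fuel gives the same state. -/
theorem replay_eq_of_le {a F : ℕ} (haF : a ≤ F) (St : Finset V × (V → ℕ)) (hfin : ¬ RCond S c (replay G S c v a St)) :
    replay G S c v F St = replay G S c v a St := by
  obtain ⟨b, rfl⟩ := Nat.exists_eq_add_of_le haF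
  rw [replay_add, replay_of_not_cond hfin]

end ReplayAlgebra

/-! ### Replay exactness when the last OR-choice may be the pointer itself -/

section Exact

variable {v : V} {St : Finset V × (V → ℕ)} {x : ℕ → V} {t : ℕ}

/-- At the timed state `k < t` the unique dominating label point is `x k` — needing `x i ≠ v` only for the choices BEFORE the last one. -/
theorem filter_max_eq_singleton' (hOR : IsORChoice G v St x t) (hv : ∀ k, k + 1 < t → x k ≠ v) {c : V → ℕ}
    (hc : HeightColoured G v St x t c) {k : ℕ} (hk : k < t) :
    ((smallestCell (timed G v St x k).1 (timed G v St x k).2 ∩ (range t).image x).filter fun y =>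
        ∀ y' ∈ smallestCell (timed G v St x k).1 (timed G v St x k).2 ∩ (range t).image x, y' ≠ y → c y' < c y) = {x k} := by
  set A := (timed G v St x k).1 with hA
  set col := (timed G v St x k).2 with hcol
  set C := smallestCell A col with hC
  have hxC : x k ∈ C := (hOR k hk).2
  have hT : ∀ y ∈ C ∩ (range t).image x, y = x k ∨ c y < c (x k) := by
    intro y hy
    rw [mem_inter, mem_image] at hy
    obtain ⟨hyC, i, hi, rfl⟩ := hy
    rw [mem_range] at hi
    rcases Nat.lt_trichotomy i k with hik | rfl | hki
    · -- an earlier choice has left the block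
      have hgone : x i ∉ (timed G v St x k).1 := fun h =>
        x_not_mem_timed_succ (smallestCell_subset _ _ (hOR i hi).2) (hv i (by omega))
          (timed_fst_subset_of_le (Nat.succ_le_of_lt hik) h)
      exact absurd (smallestCell_subset _ _ hyC) hgone
    · exact Or.inl rfl
    · right
      refine hc k i hki hi ?_
      rw [← smallestCell_eq_cellOf col hxC]; exact hyC
  ext y
  rw [mem_filter, mem_singleton]
  constructor
  · rintro ⟨hy, hmax⟩
    rcases hT y hy with h | h
    · exact h
    · exfalso
      have hxT : x k ∈ C ∩ (range t).image x := mem_inter.2 ⟨hxC, mem_image.2 ⟨k, mem_range.2 hk, rfl⟩⟩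
      have := hmax (x k) hxT (fun heq => by rw [heq] at h; exact lt_irrefl _ h)
      omega
  · rintro rfl
    refine ⟨mem_inter.2 ⟨hxC, mem_image.2 ⟨k, mem_range.2 hk, rfl⟩⟩, fun y' hy' hne => ?_⟩
    rcases hT y' hy' with h | h
    · exact absurd h hne
    · exact h

/-- **Replay exactness up to the end of the path**, the last choice possibly being the pointer: with fuel `f` from the timed state `k`,
`k + f ≤ t`, the replay reaches the timed state `k + f`. -/
theorem replay_timed_le (hOR : IsORChoice G v St x t) (hv : ∀ k, k + 1 < t → x k ≠ v) {c : V → ℕ}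
    (hc : HeightColoured G v St x t c) (f : ℕ) {k : ℕ} (hk : k + f ≤ t) :
    replay G ((range t).image x) c v f (timed G v St x k) = timed G v St x (k + f) := by
  induction f generalizing k with
  | zero => rw [replay_zero, Nat.add_zero]
  | succ f ih =>
    have hkt : k < t := by omega
    have hM := filter_max_eq_singleton' hOR hv hc hkt
    have hcond : RCond ((range t).image x) c (timed G v St x k) := ⟨(hOR k hkt).1, by rw [hM, card_singleton]⟩
    rw [replay_succ_of_cond hcond]
    have hchoose : (Finset.card_eq_one.1 hcond.2).choose = x k :=
      singleton_inj.1 ((Finset.card_eq_one.1 hcond.2).choose_spec.symm.trans hM)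
    rw [hchoose, ← timed_succ, ih (by omega)]
    congr 1; omega

/-- From the start, fuel exactly `t`: the replay ends at the end of the timed path (last choice possibly the pointer). -/
theorem replay_eq_timed_of_last (hOR : IsORChoice G v St x t) (hv : ∀ k, k + 1 < t → x k ≠ v) {c : V → ℕ}
    (hc : HeightColoured G v St x t c) : replay G ((range t).image x) c v t St = timed G v St x t := by
  have := replay_timed_le hOR hv hc t (k := 0) (by omega)
  rwa [Nat.zero_add] at this

end Exact

/-! ### Atoms: of an iterate, and of a switching-isolated vertex -/

section Atoms

/-- Iterates of the atom step compose. -/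
private theorem iterate_atomStep_add (W : Finset V) (c : V → ℕ) (v : V) (a b : ℕ) :
    (fun B => swReach G B c v)^[a] ((fun B => swReach G B c v)^[b] W) = (fun B => swReach G B c v)^[a + b] W := by
  rw [Function.iterate_add_apply]

/-- **The atom of an iterate of the atom step is the atom.** -/
theorem atom_iterate (W : Finset V) (c : V → ℕ) (v : V) (i : ℕ) :
    atom G ((fun B => swReach G B c v)^[i] W) c v = atom G W c v := by
  set f : Finset V → Finset V := fun B => swReach G B c v with hf
  -- both are fixed points on the orbit of `W`
  have h1 : atom G (f^[i] W) c v = f^[(f^[i] W).card + 1 + i] W := by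
    unfold atom; rw [iterate_atomStep_add]
  have hfix1 : f^[((f^[i] W).card + 1 + i) + 1] W = f^[(f^[i] W).card + 1 + i] W := by
    rw [Function.iterate_succ_apply', ← h1]; exact swReach_atom _ c v
  have h2 : atom G W c v = f^[W.card + 1] W := rfl
  have hfix2 : f^[(W.card + 1) + 1] W = f^[W.card + 1] W := by
    rw [Function.iterate_succ_apply', ← h2]; exact swReach_atom _ c v
  rw [h1, h2]
  rcases le_total ((f^[i] W).card + 1 + i) (W.card + 1) with hle | hle
  · exact (iterate_atomStep_stable W c v hfix1 _ hle).symm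
  · exact iterate_atomStep_stable W c v hfix2 _ hle

/-- A switching-isolated vertex of the block reaches only itself. -/
theorem swReach_eq_singleton_of_isolated {W : Finset V} {c : V → ℕ} {u : V} (hu : u ∈ W)
    (hiso : ∀ b ∈ W, ¬ (swGraph G W c).Adj u b) : swReach G W c u = {u} := by
  have key : ∀ n, (swExpand G W c)^[n] ({u} ∩ W) = {u} := by
    intro n
    induction n with
    | zero => rw [Function.iterate_zero, id_eq, inter_eq_left.2 (singleton_subset_iff.2 hu)]
    | succ n ih =>
      rw [Function.iterate_succ_apply', ih, swExpand]
      refine union_eq_left.2 fun b hb => ?_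
      rw [mem_filter] at hb
      obtain ⟨hbW, a, ha, hab⟩ := hb
      rw [mem_singleton] at ha
      subst ha
      exact absurd hab (hiso b hbW)
  exact key _

/-- **The atom of a switching-isolated vertex is the vertex.** -/
theorem atom_eq_singleton_of_isolated {W : Finset V} {c : V → ℕ} {u : V} (hu : u ∈ W)
    (hiso : ∀ b ∈ W, ¬ (swGraph G W c).Adj u b) : atom G W c u = {u} := by
  have h1 : (fun B => swReach G B c u)^[1] W = {u} := by
    rw [Function.iterate_one]; exact swReach_eq_singleton_of_isolated hu hiso
  rw [← h1]
  refine atom_eq_iterate_of_fixed W c u 1 ?_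
  rw [h1]
  exact swReach_eq_singleton_of_isolated (mem_singleton_self u) fun b hb hadj => by
    rw [mem_singleton] at hb; subst hb; exact hadj.1 rfl

/-- After individualising `u ∈ B` and refining inside `B`, the atom of `u` is `{u}`. -/
theorem atom_refineIn_indiv_self {B : Finset V} (col : V → ℕ) {u : V} (hu : u ∈ B) :
    atom G B (refineIn G B (indiv col u)) u = {u} :=
  atom_eq_singleton_of_isolated hu fun _ hb =>
    not_swAdj_of_cell_singleton (fun _ ha _ ha' haa' _ hw => equitableIn_refineIn (G := G) B (indiv col u) ha ha' haa' hw) hu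
      (cellOf_refineIn_indiv col hu) hb

end Atoms

end BranchSum

end Summit.PneNP.PneNP.Theorems
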